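import Mathlib
import HarnessLib
import Summits.AtomisticToContinuum.Crystallization.Theorems.PricedLinkCensusSoftFourRingsEndgame
import Summits.AtomisticToContinuum.Crystallization.Theorems.PricedLinkCensusSoftFourRingsDefs
import Summits.AtomisticToContinuum.Crystallization.Theorems.PricedLinkCensusSoftFourRingsAssembly

/-!
# Soft four-rings: `EndgameRigidity` reduces to the metric `LabelledRigidity`

Route `PricedLinkCensus`, sub-problem `Crystallization`, item `SoftFourRings`
(stmt-AtomisticToContinuum-14234).  With the combinatorial endgame `bond_graph_fcc_or_hcp` in
hand, the route-posited `EndgameRigidity δ` (`PricedLinkCensusSoftFourRingsDefs`) follows from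
Tammes-13 and the purely metric `LabelledRigidity δ`:

* `endgameRigidity_of_labelledRigidity : musinTarasov2012_tammes_thirteen → LabelledRigidity δ →
    EndgameRigidity δ`;
* hence (`softFourRings_of_labelledRigidity`, with `softFourRings_of_endgameRigidity`)
  `musinTarasov2012_tammes_thirteen → LabelledRigidity (6/25) → SoftFourRings`.
-/

namespace Summit.AtomisticToContinuum.Crystallization.Theorems

open Real RealInnerProductSpace Literature.Geometry.DiscreteGeometry

/-- **`EndgameRigidity` from Tammes-13 and labelled rigidity.** -/
theorem endgameRigidity_of_labelledRigidity (hT : musinTarasov2012_tammes_thirteen) {δ : ℝ}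
    (hLR : LabelledRigidity δ) : EndgameRigidity δ := by
  intro X B hX1 hcard hsepX hB hBcard hdeg hnonbond _h0 _h34 _hT8 _ht2
  obtain ⟨p, hinj, hpX, hgraph⟩ := bond_graph_fcc_or_hcp hT hX1 hcard hsepX hB hBcard hdeg
  have hp1 : ∀ i, ‖p i‖ = 1 := fun i => hX1 _ (hpX i)
  have hsep : ∀ i j, i ≠ j → ⟪p i, p j⟫ ≤ 1 - 1 / (2 * (101 / 100 : ℝ) ^ 2) :=
    fun i j hij => hsepX _ (hpX i) _ (hpX j) (hinj.ne hij)
  rcases hgraph with hg | hg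
  · have hbond : ∀ i j, fccAdj i j → 1 - (101 / 100 : ℝ) ^ 2 / 2 ≤ ⟪p i, p j⟫ := by
      intro i j h
      have hmem := (hg i j).2 h
      exact (close_of_pair_mem_bonds hB hmem (ne_of_mem_bonds hB hmem)).2.2
    have hnb : ∀ i j, i ≠ j → ¬ fccAdj i j → ⟪p i, p j⟫ < 101 / 200 :=
      fun i j hij hadj => hnonbond _ (hpX i) _ (hpX j) (hinj.ne hij) (mt (hg i j).1 hadj)
    obtain ⟨A, hA⟩ := hLR.1 p hp1 hsep hbond hnb
    refine ⟨A, fccKissingPattern, Or.inl rfl, fun q hq => ?_⟩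
    obtain ⟨i, hi⟩ := hA q hq
    exact ⟨p i, hpX i, hi⟩
  · have hbond : ∀ i j, hcpAdj i j → 1 - (101 / 100 : ℝ) ^ 2 / 2 ≤ ⟪p i, p j⟫ := by
      intro i j h
      have hmem := (hg i j).2 h
      exact (close_of_pair_mem_bonds hB hmem (ne_of_mem_bonds hB hmem)).2.2
    have hnb : ∀ i j, i ≠ j → ¬ hcpAdj i j → ⟪p i, p j⟫ < 101 / 200 :=
      fun i j hij hadj => hnonbond _ (hpX i) _ (hpX j) (hinj.ne hij) (mt (hg i j).1 hadj)
    obtain ⟨A, hA⟩ := hLR.2 p hp1 hsep hbond hnb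
    refine ⟨A, hcpKissingPattern, Or.inr rfl, fun q hq => ?_⟩
    obtain ⟨i, hi⟩ := hA q hq
    exact ⟨p i, hpX i, hi⟩


/-- **`SoftFourRings` modulo Tammes-13 and labelled (metric) rigidity.** -/
theorem softFourRings_of_labelledRigidity (hT : musinTarasov2012_tammes_thirteen) {δ : ℝ}
    (hδ : δ ≤ 6 / 25) (hLR : LabelledRigidity δ) :
    Summit.AtomisticToContinuum.Crystallization.Theses.PricedLinkCensus.SoftFourRings :=
  softFourRings_of_endgameRigidity hT hδ (endgameRigidity_of_labelledRigidity hT hLR)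

end Summit.AtomisticToContinuum.Crystallization.Theorems
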